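import Summits.CriticalPhenomena.PercolationContinuityZ3.Theorems.SahiBoxTP2GibbsHilbert
import Summits.CriticalPhenomena.PercolationContinuityZ3.Theorems.SahiBoxTP2HilbertReindex

/-!
# Ferromagnetic continuous-spin Gibbs measures on `[0,1]^ι`, `ι` countable (e.g. `ι = ℤ^d`)

Support file of the Sahi cell (`prim-sahi`, typer seat, generation 14; `--supports stmt-CriticalPhenomena-4575`).
Theorems only (no definitions, no named facts, no sorries).  The `ι`-indexed (relabelled along `e : ι ≃ ℕ`) forms
of `SahiBoxTP2TiltHilbert.lean` / `SahiBoxTP2GibbsHilbert.lean`, so that lattice systems indexed by `ℤ^d` are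
covered literally:

* `isBoxTP2_infinitePi_countable` — every product probability measure `⊗_{x ∈ ι} μ_x` on `ι → [0,1]` is box-TP₂
  (Mathlib's `infinitePi_map_piCongrLeft` + invariance under relabelling);
* `IsBoxTP2.withDensity_of_continuous_hilbert_countable` — tilting a finite box-TP₂ law on `ι → [0,1]` by a
  continuous log-supermodular density preserves box-TP₂;
* `isBoxTP2_gibbs_hilbert_countable` — `e^{−H} · ⊗_x μ_x` is box-TP₂ for `H` continuous submodular and ANY one-site
  laws (any boundary condition); `isBoxTP2_of_tendsto_gibbs_hilbert_countable` — and so is every weak limit of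
  normalised such measures; `integral_mul_integral_le_of_tendsto_gibbs_hilbert_countable` (FKG),
  `msahiE_nonneg_of_tendsto_gibbs_hilbert_countable_of_sahiConjecture` (Sahi positivity of every order given `C_n`).

No sorries, no new axioms.
-/

noncomputable section

namespace Summit.CriticalPhenomena.PercolationContinuityZ3.Theorems.SahiBoxTP2

open MeasureTheory Set Filter Topology Function Literature.Combinatorics.Sahi2008
open scoped ENNReal NNReal unitInterval

variable {ι : Type*}

/-- Mathlib's reindexing `piCongrLeft _ e.symm : (ℕ → X) ≃ᵐ (ι → X)` is the cell's `reindex e`. [folklore] -/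
theorem coe_piCongrLeft_symm_eq_reindex {X : Type*} [MeasurableSpace X] [Preorder X] (e : ι ≃ ℕ) :
    ⇑(MeasurableEquiv.piCongrLeft (fun _ : ι => X) e.symm) = reindex (X := X) e := by
  funext u i
  have h := MeasurableEquiv.piCongrLeft_apply_apply e.symm (β := fun _ : ι => X) u (e i)
  rw [Equiv.symm_apply_apply] at h
  rw [h, reindex_apply]

/-- **Every product probability measure on `ι → [0,1]` (`ι ≃ ℕ`) is box-TP₂.** [this work] -/
theorem isBoxTP2_infinitePi_countable (e : ι ≃ ℕ) (μ : ι → Measure I) [∀ i, IsProbabilityMeasure (μ i)] :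
    IsBoxTP2 (Measure.infinitePi μ) := by
  rw [← Measure.infinitePi_map_piCongrLeft μ e.symm, coe_piCongrLeft_symm_eq_reindex e]
  exact (isBoxTP2_infinitePi fun k => μ (e.symm k)).map_orderIso (reindex e) (measurableEmbedding_reindex e)

section Tilt

variable {μ : Measure (ι → I)} [IsFiniteMeasure μ]

/-- **Box-TP₂ on `ι → [0,1]` (`ι ≃ ℕ`) is preserved by continuous log-supermodular tilts.** [this work] -/
theorem IsBoxTP2.withDensity_of_continuous_hilbert_countable (e : ι ≃ ℕ) (hμ : IsBoxTP2 μ) {ρ : (ι → I) → ℝ≥0}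
    (hρc : Continuous ρ) (hρ : ∀ u v, ρ u * ρ v ≤ ρ (u ⊓ v) * ρ (u ⊔ v)) :
    IsBoxTP2 (μ.withDensity fun u => (ρ u : ℝ≥0∞)) := by
  rw [← isBoxTP2_map_reindex_symm_iff e]
  haveI : IsFiniteMeasure (μ.map (reindex (X := I) e).symm) := Measure.isFiniteMeasure_map μ _
  have hrc : Continuous (reindex (X := I) e : (ℕ → I) → ι → I) :=
    continuous_pi fun i => by simpa only [reindex_apply] using continuous_apply (e i)
  have hfac : (fun u : ι → I => (ρ u : ℝ≥0∞)) =
      (fun v : ℕ → I => (ρ (reindex e v) : ℝ≥0∞)) ∘ (reindex (X := I) e).symm := by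
    funext u
    simp only [Function.comp_apply, OrderIso.apply_symm_apply]
  have hgm : Measurable fun v : ℕ → I => (ρ (reindex e v) : ℝ≥0∞) :=
    (ENNReal.continuous_coe.comp (hρc.comp hrc)).measurable
  rw [hfac, map_withDensity_comp μ (measurableEmbedding_reindex_symm e).measurable hgm]
  exact ((isBoxTP2_map_reindex_symm_iff e μ).2 hμ).withDensity_of_continuous_hilbert (ρ := fun v => ρ (reindex e v))
    (hρc.comp hrc) fun u v => by rw [(reindex (X := I) e).map_inf, (reindex (X := I) e).map_sup]; exact hρ _ _

/-- **Gibbs modifications on `ι → [0,1]`**: `e^{−H} μ` is box-TP₂ for `μ` finite box-TP₂ and `H` continuous submodular.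
[this work] -/
theorem IsBoxTP2.withDensity_exp_of_submodular_hilbert_countable (e : ι ≃ ℕ) (hμ : IsBoxTP2 μ) {H : (ι → I) → ℝ}
    (hHc : Continuous H) (hH : ∀ u v, H (u ⊓ v) + H (u ⊔ v) ≤ H u + H v) :
    IsBoxTP2 (μ.withDensity fun u => ENNReal.ofReal (Real.exp (-H u))) :=
  hμ.withDensity_of_continuous_hilbert_countable e (ρ := fun u => Real.toNNReal (Real.exp (-H u)))
    (continuous_real_toNNReal.comp (Real.continuous_exp.comp hHc.neg)) fun u v => by
      rw [← Real.toNNReal_mul (Real.exp_pos _).le, ← Real.toNNReal_mul (Real.exp_pos _).le, ← Real.exp_add,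
        ← Real.exp_add]
      exact Real.toNNReal_le_toNNReal (Real.exp_le_exp.2 (by linarith [hH u v]))

end Tilt

section Gibbs

/-- **Finite-volume ferromagnetic continuous-spin Gibbs measures on `ι → [0,1]` are box-TP₂, for every boundary
condition**: `e^{−H} · ⊗_x μ_x` with `H` continuous submodular and any one-site laws `μ_x`. [this work] -/
theorem isBoxTP2_gibbs_hilbert_countable (e : ι ≃ ℕ) (μ : ι → Measure I) [∀ i, IsProbabilityMeasure (μ i)]
    {H : (ι → I) → ℝ} (hHc : Continuous H) (hH : ∀ u v, H (u ⊓ v) + H (u ⊔ v) ≤ H u + H v) :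
    IsBoxTP2 ((Measure.infinitePi μ).withDensity fun u => ENNReal.ofReal (Real.exp (-H u))) :=
  (isBoxTP2_infinitePi_countable e μ).withDensity_exp_of_submodular_hilbert_countable e hHc hH

variable [Countable ι] (e : ι ≃ ℕ) {κ : Type*} {L : Filter κ} [NeBot L]
include e

/-- **Every weak limit of finite-volume ferromagnetic Gibbs measures on `ι → [0,1]` is box-TP₂** (volumes, boundary
conditions / one-site laws and continuous submodular interactions varying along any filter). [this work] -/
theorem isBoxTP2_of_tendsto_gibbs_hilbert_countable {μs : κ → ProbabilityMeasure (ι → I)}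
    {μ : ProbabilityMeasure (ι → I)} (hconv : Tendsto μs L (𝓝 μ))
    (hμs : ∀ k, ∃ (c : ℝ≥0∞) (P : ι → Measure I) (_ : ∀ i, IsProbabilityMeasure (P i)) (H : (ι → I) → ℝ),
      Continuous H ∧ (∀ u v, H (u ⊓ v) + H (u ⊔ v) ≤ H u + H v) ∧
        (μs k : Measure (ι → I)) = c • (Measure.infinitePi P).withDensity fun u => ENNReal.ofReal (Real.exp (-H u))) :
    IsBoxTP2 (μ : Measure (ι → I)) := by
  refine isBoxTP2_of_tendsto_probabilityMeasure_hilbert_countable e hconv (Eventually.of_forall fun k => ?_)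
  obtain ⟨c, P, hP, H, hHc, hH, hk⟩ := hμs k
  rw [hk]
  exact (isBoxTP2_gibbs_hilbert_countable e P hHc hH).smul c

/-- **FKG for weak limits of ferromagnetic continuous-spin Gibbs measures on `ι → [0,1]`.** [this work] -/
theorem integral_mul_integral_le_of_tendsto_gibbs_hilbert_countable {μs : κ → ProbabilityMeasure (ι → I)}
    {μ : ProbabilityMeasure (ι → I)} (hconv : Tendsto μs L (𝓝 μ))
    (hμs : ∀ k, ∃ (c : ℝ≥0∞) (P : ι → Measure I) (_ : ∀ i, IsProbabilityMeasure (P i)) (H : (ι → I) → ℝ),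
      Continuous H ∧ (∀ u v, H (u ⊓ v) + H (u ⊔ v) ≤ H u + H v) ∧
        (μs k : Measure (ι → I)) = c • (Measure.infinitePi P).withDensity fun u => ENNReal.ofReal (Real.exp (-H u)))
    {f g : (ι → I) → ℝ} (hfm : Measurable f) (hgm : Measurable g) (hf0 : ∀ u, 0 ≤ f u) (hg0 : ∀ u, 0 ≤ g u)
    (hf : Monotone f) (hg : Monotone g) :
    (∫ u, f u ∂(μ : Measure (ι → I))) * (∫ u, g u ∂(μ : Measure (ι → I))) ≤
      ∫ u, f u * g u ∂(μ : Measure (ι → I)) :=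
  integral_mul_integral_le_of_isBoxTP2_countable e (μ : Measure (ι → I))
    (isBoxTP2_of_tendsto_gibbs_hilbert_countable e hconv hμs) hfm hgm hf0 hg0 hf hg

/-- **Sahi positivity of every order, given `C_n`, for weak limits of ferromagnetic continuous-spin Gibbs measures on
`ι → [0,1]`.** [this work; conditional on Sahi's conjecture `C_n`] -/
theorem msahiE_nonneg_of_tendsto_gibbs_hilbert_countable_of_sahiConjecture {n : ℕ} (hC : SahiConjecture n)
    {μs : κ → ProbabilityMeasure (ι → I)} {μ : ProbabilityMeasure (ι → I)} (hconv : Tendsto μs L (𝓝 μ))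
    (hμs : ∀ k, ∃ (c : ℝ≥0∞) (P : ι → Measure I) (_ : ∀ i, IsProbabilityMeasure (P i)) (H : (ι → I) → ℝ),
      Continuous H ∧ (∀ u v, H (u ⊓ v) + H (u ⊔ v) ≤ H u + H v) ∧
        (μs k : Measure (ι → I)) = c • (Measure.infinitePi P).withDensity fun u => ENNReal.ofReal (Real.exp (-H u)))
    (f : Fin n → (ι → I) → ℝ) (hfm : ∀ i, Measurable (f i)) (hf0 : ∀ i u, 0 ≤ f i u)
    (hmono : ∀ i, Monotone (f i)) : 0 ≤ msahiE (μ : Measure (ι → I)) n f :=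
  msahiE_nonneg_of_isBoxTP2_countable_of_sahiConjecture e hC (μ : Measure (ι → I))
    (isBoxTP2_of_tendsto_gibbs_hilbert_countable e hconv hμs) f hfm hf0 hmono

end Gibbs

end Summit.CriticalPhenomena.PercolationContinuityZ3.Theorems.SahiBoxTP2
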